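import Mathlib
import HarnessLib
import Literature.Geometry.DiscreteGeometry.SphericalCodeHullEulerFormula
import Summits.AtomisticToContinuum.Crystallization.Theorems.PricedLinkCensusSoftFourRingsHullBridge
import Summits.AtomisticToContinuum.Crystallization.Theorems.PricedLinkCensusSoftFourRingsCapInterior
import Summits.AtomisticToContinuum.Crystallization.Theorems.PricedLinkCensusSoftFourRingsCapFacetFour

/-!
# The hull of the twelve link directions: edge and facet counts

Route `PricedLinkCensus`, item `SoftFourRings` (stmt-AtomisticToContinuum-14234), evidence
`softrings-search.md` §12.  For twelve unit vectors `X ⊂ ℝ³` pairwise at inner product `≤ ca`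
(`ca = 1 − 1/(2·(101/100)²)`, angle `≥ 59.35°`) carrying a family `B` of 24 soft bonds
(`⟪u, v⟫ ≥ cb = 1 − (101/100)²/2`), and CONDITIONAL on Tammes-13
(`musinTarasov2012_tammes_thirteen`), the face structure of `conv X` from
`Literature.Geometry.DiscreteGeometry.SphericalCodeHullEuler*` satisfies:
`0 ∈ interior (conv X)` (`Interior`), every bond is a hull edge (`HullBridge`),
`24 ≤ E ≤ 30` hull edges, `F = E − 10` facets (Euler), every facet has 3 or 4 vertices (`FacetFour`),
and hence exactly `F₄ = 30 − E ≤ 6` quadrilateral and `F₃ = 2E − 40` triangular facets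
(`hull_counts_of_twelve`).  These are the global counts feeding the classification step (G4/G5).

**`Cap` variant** (seat c3 of stmt-AtomisticToContinuum-14234): identical to `PricedLinkCensusSoftFourRingsGlobal`, except that the
global Tammes-13 hypothesis `(hT : musinTarasov2012_tammes_thirteen)` is replaced by the LOCAL covering
property of the twelve directions, `hT : ∀ p, ‖p‖ = 1 → ∃ x ∈ X, dist p x < 0.957` (no empty cap of
angular radius `57.18°`), which is all the two roots (`FacetCap`, `Interior`) ever used; the hT-free
lemmas are not repeated (the original file is imported for them).
-/

namespace Summit.AtomisticToContinuum.Crystallization.Theorems.Cap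

open Real RealInnerProductSpace Literature.Geometry.DiscreteGeometry

/-- **Edge and facet counts of the hull of the twelve link directions** (conditional on
Tammes-13).  Twelve unit vectors pairwise at inner product `≤ 1 − 1/(2·(101/100)²)`, a family `B`
of 24 distinct bonded pairs (`⟪u, v⟫ ≥ 1 − (101/100)²/2`): then `0 ∈ interior (conv X)`,
`B ⊆ hullEdges X`, `24 ≤ #hullEdges X ≤ 30`, `#facetNormals X + 10 = #hullEdges X`, every facet
has 3 or 4 vertices, `#{quadrilateral facets} + #hullEdges X = 30` and
`#{triangular facets} + 40 = 2 #hullEdges X`. [cite: MusinTarasov2012, Theorem 1] -/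
theorem hull_counts_of_twelve {X : Finset (EuclideanSpace ℝ (Fin 3))}
    (hT : ∀ p : EuclideanSpace ℝ (Fin 3), ‖p‖ = 1 → ∃ x ∈ X, dist p x < 0.957)
    (hX1 : ∀ y ∈ X, ‖y‖ = 1) (hcard : X.card = 12)
    (hsep : ∀ u ∈ X, ∀ v ∈ X, u ≠ v → ⟪u, v⟫ ≤ 1 - 1 / (2 * (101 / 100 : ℝ) ^ 2))
    {B : Finset (Finset (EuclideanSpace ℝ (Fin 3)))}
    (hB : ∀ T ∈ B, ∃ u ∈ X, ∃ v ∈ X, u ≠ v ∧ 1 - (101 / 100 : ℝ) ^ 2 / 2 ≤ ⟪u, v⟫ ∧ T = {u, v})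
    (hBcard : B.card = 24) :
    (0 : EuclideanSpace ℝ (Fin 3)) ∈
        interior (convexHull ℝ (X : Set (EuclideanSpace ℝ (Fin 3)))) ∧
      B ⊆ hullEdges X ∧ 24 ≤ (hullEdges X).card ∧ (hullEdges X).card ≤ 30 ∧
      (facetNormals X).card + 10 = (hullEdges X).card ∧
      (∀ c ∈ facetNormals X, (tightSet X c).card = 3 ∨ (tightSet X c).card = 4) ∧
      ((facetNormals X).filter (fun c => (tightSet X c).card = 4)).card + (hullEdges X).card
        = 30 ∧
      ((facetNormals X).filter (fun c => (tightSet X c).card = 3)).card + 40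
        = 2 * (hullEdges X).card := by
  classical
  have h0 := zero_mem_interior_convexHull_of_twelve_le_card hT hX1 hcard.ge (by norm_num) hsep
  have hsub : B ⊆ hullEdges X :=
    subset_hullEdges_of_soft_bonds hX1 (by norm_num) (by norm_num) hsep hB
  have h24 : 24 ≤ (hullEdges X).card := hBcard ▸ Finset.card_le_card hsub
  have h30 : (hullEdges X).card ≤ 30 := by
    have := card_hullEdges_le hX1 h0
    omega
  have hE := euler_formula hX1 h0
  rw [hcard] at hE
  have h34 : ∀ c ∈ facetNormals X, (tightSet X c).card = 3 ∨ (tightSet X c).card = 4 := by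
    intro c hc
    have h3 := three_le_card_tightSet hc
    have h4 := card_tightSet_le_four_of_twelve_le_card hT hX1 hcard.ge hsep (mem_facetNormals.1 hc).1
    omega
  have hsum := sum_card_tightSet_eq_two_mul_card_hullEdges hX1 h0
  rw [← Finset.sum_filter_add_sum_filter_not (facetNormals X) (fun c => (tightSet X c).card = 3)]
    at hsum
  have hS3 : ∑ c ∈ (facetNormals X).filter (fun c => (tightSet X c).card = 3), (tightSet X c).card
      = ((facetNormals X).filter (fun c => (tightSet X c).card = 3)).card * 3 :=
    Finset.sum_const_nat (fun c hc => (Finset.mem_filter.1 hc).2)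
  have hfilt : (facetNormals X).filter (fun c => ¬ (tightSet X c).card = 3)
      = (facetNormals X).filter (fun c => (tightSet X c).card = 4) := by
    apply Finset.filter_congr
    intro c hc
    rcases h34 c hc with h | h
    · rw [h]; norm_num
    · rw [h]; norm_num
  have hS4 : ∑ c ∈ (facetNormals X).filter (fun c => ¬ (tightSet X c).card = 3),
      (tightSet X c).card = ((facetNormals X).filter (fun c => (tightSet X c).card = 4)).card * 4 := by
    rw [hfilt]
    exact Finset.sum_const_nat (fun c hc => (Finset.mem_filter.1 hc).2)
  rw [hS3, hS4] at hsum
  have hF := Finset.card_filter_add_card_filter_not (s := facetNormals X)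
    (fun c => (tightSet X c).card = 3)
  rw [hfilt] at hF
  refine ⟨h0, hsub, h24, h30, by omega, h34, by omega, by omega⟩

end Summit.AtomisticToContinuum.Crystallization.Theorems.Cap
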